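/-
Copyright (c) 2026 the pub-hodgecm-mathlib formalisation cell (harness21).  Prover seat hodgecm-mathlib-LH4-p13 (g2), req620 Track A «(D-RAM) FOUR-FRAME» squad
(heir LEAD F0P3a-plan lineage; dealer LH4-plan lineage; MS ROAD A, Stage B brick B4₂ «SPLIT STRATA, TYPE 2», FILE 5: the B10₂ SOCKETS).  2026-09-04.
-/
import Summits.HodgeConjecture.HodgeConjecture.Theorems.F0P3cDyRamDiagonalSplitCountTwo          -- B4₂ FILE 2 (this seat): axis 3, type 2
import Summits.HodgeConjecture.HodgeConjecture.Theorems.F0P3cDyRamDiagonalSplitCountTwoAxisOne   -- B4₂ FILE 3 (this seat): axis 1, type 2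
import Summits.HodgeConjecture.HodgeConjecture.Theorems.F0P3cDyRamDiagonalSplitCountTwoAxisTwo   -- B4₂ FILE 4 (this seat): axis 2, type 2
import Summits.HodgeConjecture.HodgeConjecture.Theorems.F0P3cDyRamDiagonalSplitCountSockets      -- ★ B4 FILE 5 p856064 (this seat): `hasAxis_axis{3,1,2}_iff`; brings ★ StrataDefs, ★ `UnitaryThreeFourFrameDefs`
import HarnessLib

/-!
# Crux `H413`, MS ROAD A, STAGE B brick B4₂ «SPLIT STRATA, TYPE 2», FILE 5: THE B10₂ SOCKETS `stub_P_T3 ∕ stub_B4_T1 ∕ stub_P_T2` OF LH4-p10 (g2)'s TYPE-2 SKELETON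
# (`B10-StableCountTypeTwo.SKELETON.v1` 08e5e6e2d02c47d3) over ★ `StrataDefs` ED. 2 (`stratumTwo`, `IsTypeTwoPolarisable`; LH4-p11 (g2)) BY NAME

Cell `hodgecm-mathlib` (D-0151), FLOOR 0, crux item H413 = `stmt-HodgeConjecture-24833`, route of record `HCCMUnconditional`; squad F0∕P3c∕LH4 (req618∕req620).  THEOREMS ONLY
(no `def`, no instance, no notation, no `sorry`, default heartbeats); lane `--supports stmt-HodgeConjecture-24833 --as helper` (count-neutral).  Road target: tree
`Cruxes/H413/Lines/F0_P3c_DyRamFourFrame_U3_Laws.lean` stub `stub_U3_stableModelSum` (MS), type-2 half via B10₂ `finsum_stabiliserWeight_typeTwoPolarisable_eq`.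
THE SOCKET SHAPE: `∑ᶠ M ∈ stratumTwo σ ϖ T a, stabiliserWeight σ M = if ¬ 2 ∣ s ∧ s ≤ nᵢ then (Fintype.card 𝓀[K] : ℚ) ^ (s ∕ 2) else 0` for the on-branch axis vectors
`a = (s,s,0), (0,s,s), (s,0,s)` (`s ≥ 1`), under `(hD : IsRamifiedQuadraticDatum σ ϖ d t) (hE : IsElementDatum σ ϖ N₀ α β n₁ n₂ n₃) (hT : T = diag(α, β, 1))`, `[Fintype 𝓀[K]]`, `K : Type`.
There is NO type-2 core (the root `𝒪³` is self-dual only: `coreTwo_eq_empty`).  PROOF: ★ B4 FILE 5's bridges `HasAxis a ↔ normal form` (type-free) turn `stratumTwo` into FILES 2–4's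
normal-form strata; their orbit ∕ empty ∕ even-empty trichotomy makes the `if` exhaustive; `Nat.card = Fintype.card`.
HONEST LABEL.  Count-neutral (`--supports`); nothing printed is asserted; (MS) and the census laws stay PROVER TARGETS until the Stage B bricks and B10∕B10₂ land; `HC_CM` is proved only
modulo the 7 printed citations (2 remaining named inputs: hLiu418 = `stmt-HodgeConjecture-24832`, h413 = `stmt-HodgeConjecture-24833`) until rung 0 closes.

## References
* [Kottwitz1986BaseChangeUnits] R. E. Kottwitz, *Base change for unit elements of Hecke algebras*, Compositio Math. 60 (1986), §1 pp. 240–241.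
* [Rogawski1990] J. D. Rogawski, *Automorphic Representations of Unitary Groups in Three Variables*, Ann. of Math. Stud. 123 (1990), §4.9 Prop. 4.9.1 (a) p. 55.
* [Jacobowitz1962] R. Jacobowitz, *Hermitian forms over local fields*, Amer. J. Math. 84 (1962), §7–§8.
-/

set_option autoImplicit false

noncomputable section

namespace Summit.HodgeConjecture.HodgeConjecture.Cruxes.H413.F0P3cDyRamDiagonalSplitCountTwoSockets

open Matrix
open Literature.NumberTheory.Automorphic Literature.NumberTheory.Automorphic.HermitianLattice
open Literature.NumberTheory.Automorphic.UnitaryLatticeTree Literature.NumberTheory.Automorphic.UnitaryThreeFourFrame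
open Summit.HodgeConjecture.HodgeConjecture.Cruxes.H413.F0P3cDyRamDiagonalTorusDefs
open Summit.HodgeConjecture.HodgeConjecture.Cruxes.H413.F0P3cDyRamDiagonalStrataDefs
open Summit.HodgeConjecture.HodgeConjecture.Cruxes.H413.F0P3cDyRamDiagonalSplitCountTwo
open Summit.HodgeConjecture.HodgeConjecture.Cruxes.H413.F0P3cDyRamDiagonalSplitCountTwoAxisOne
open Summit.HodgeConjecture.HodgeConjecture.Cruxes.H413.F0P3cDyRamDiagonalSplitCountTwoAxisTwo
open Summit.HodgeConjecture.HodgeConjecture.Cruxes.H413.F0P3cDyRamDiagonalSplitCountSockets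
open scoped Valued WithZero Matrix MatrixGroups

section Sockets

variable {K : Type} [Field K] [Valued K ℤᵐ⁰] [Fintype 𝓀[K]] {σ : K →+* K} {ϖ : K} {d t : ℕ} {α β : K} {N₀ n₁ n₂ n₃ : ℕ} {T : GL (Fin 3) K}

/-- **SOCKET `stub_P_T3` (type 2) — AXIS `(s,s,0)`**: `∑ᶠ_{M ∈ stratumTwo(T, (s,s,0))} 1∕[𝒰 : S_F(M)] = q^(s∕2)` if `s` is ODD and `s ≤ n₃`, else `0` (`s ≥ 1`).
[cite: Rogawski1990, §4.9 Prop. 4.9.1 (a) p. 55] [cite: Kottwitz1986BaseChangeUnits, §1 pp. 240–241] -/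
theorem finsum_stabiliserWeight_stratumTwo_T3 (hD : IsRamifiedQuadraticDatum σ ϖ d t) (hE : IsElementDatum σ ϖ N₀ α β n₁ n₂ n₃)
    (hT : (T : Matrix (Fin 3) (Fin 3) K) = Matrix.diagonal ![α, β, 1]) (s : ℕ) (hs : 1 ≤ s) :
    ∑ᶠ M ∈ stratumTwo σ ϖ T ![s, s, 0], stabiliserWeight σ M = if ¬ 2 ∣ s ∧ s ≤ n₃ then ((Fintype.card 𝓀[K] : ℚ) ^ (s / 2)) else 0 := by
  obtain ⟨hσ, hvσ, hϖ, hfix, hd, -, -⟩ := hD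
  obtain ⟨hαn, hβn, -, -, -, -, -, h₃, -, -, -⟩ := hE
  have hα := v_eq_one_of_mul_map_eq_one hvσ hαn
  have hβ := v_eq_one_of_mul_map_eq_one hvσ hβn
  have hset : stratumTwo σ ϖ T ![s, s, 0] = {M | M ∈ normalisedStableLattices T ∧
      (∃ D : Fin 3 → K, (∀ i, σ (D i) = D i ∧ D i ≠ 0) ∧ IsVertexLattice σ ϖ (Matrix.diagonal D) 2 M) ∧
      ∃ x : K, Valued.v x = 1 ∧ M = latt (!![1, 0, 0; x, ϖ ^ s, 0; 0, 0, 1] : Matrix (Fin 3) (Fin 3) K)} :=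
    Set.ext fun M => ⟨fun ⟨h1, h2, h3⟩ => ⟨h1, h2, (hasAxis_axis3_iff hϖ h1 hs).1 h3⟩, fun ⟨h1, h2, h3⟩ => ⟨h1, h2, (hasAxis_axis3_iff hϖ h1 hs).2 h3⟩⟩
  rw [hset]
  split_ifs with hc
  · rw [← Nat.card_eq_fintype_card]
    exact finsum_stabiliserWeight_axis3StratumTwo hσ hvσ hfix hϖ hd T hT hα hβ (map_one _) h₃ hc.1 hc.2
  · rcases not_and_or.1 hc with heven | hlt
    · rw [axis3StratumTwo_eq_empty_of_two_dvd hvσ hfix hϖ T (not_not.1 heven), finsum_mem_empty]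
    · rw [axis3StratumTwo_eq_empty σ hϖ T hT hα hβ (map_one _) h₃ (not_le.1 hlt), finsum_mem_empty]

/-- **SOCKET `stub_B4_T1` (type 2) — AXIS `(0,s,s)`**: `q^(s∕2)` if `s` is odd and `s ≤ n₁`, else `0` (`s ≥ 1`). [cite: Rogawski1990, §4.9 Prop. 4.9.1 (a) p. 55] -/
theorem finsum_stabiliserWeight_stratumTwo_T1 (hD : IsRamifiedQuadraticDatum σ ϖ d t) (hE : IsElementDatum σ ϖ N₀ α β n₁ n₂ n₃)
    (hT : (T : Matrix (Fin 3) (Fin 3) K) = Matrix.diagonal ![α, β, 1]) (s : ℕ) (hs : 1 ≤ s) :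
    ∑ᶠ M ∈ stratumTwo σ ϖ T ![0, s, s], stabiliserWeight σ M = if ¬ 2 ∣ s ∧ s ≤ n₁ then ((Fintype.card 𝓀[K] : ℚ) ^ (s / 2)) else 0 := by
  obtain ⟨hσ, hvσ, hϖ, hfix, hd, -, -⟩ := hD
  obtain ⟨hαn, hβn, -, -, -, h₁, -, -, -, -, -⟩ := hE
  have hα := v_eq_one_of_mul_map_eq_one hvσ hαn
  have hβ := v_eq_one_of_mul_map_eq_one hvσ hβn
  have hset : stratumTwo σ ϖ T ![0, s, s] = {M | M ∈ normalisedStableLattices T ∧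
      (∃ D : Fin 3 → K, (∀ i, σ (D i) = D i ∧ D i ≠ 0) ∧ IsVertexLattice σ ϖ (Matrix.diagonal D) 2 M) ∧
      ∃ z : K, Valued.v z = 1 ∧ M = latt (!![1, 0, 0; 0, 1, 0; 0, z, ϖ ^ s] : Matrix (Fin 3) (Fin 3) K)} :=
    Set.ext fun M => ⟨fun ⟨h1, h2, h3⟩ => ⟨h1, h2, (hasAxis_axis1_iff hϖ h1 hs).1 h3⟩, fun ⟨h1, h2, h3⟩ => ⟨h1, h2, (hasAxis_axis1_iff hϖ h1 hs).2 h3⟩⟩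
  rw [hset]
  split_ifs with hc
  · rw [← Nat.card_eq_fintype_card]
    exact finsum_stabiliserWeight_axis1StratumTwo hσ hvσ hfix hϖ hd T hT hα hβ (map_one _) h₁ hc.1 hc.2
  · rcases not_and_or.1 hc with heven | hlt
    · rw [axis1StratumTwo_eq_empty_of_two_dvd hvσ hfix hϖ T (not_not.1 heven), finsum_mem_empty]
    · rw [axis1StratumTwo_eq_empty σ hϖ T hT hα hβ (map_one _) h₁ (not_le.1 hlt), finsum_mem_empty]

/-- **SOCKET `stub_P_T2` (type 2) — AXIS `(s,0,s)`**: `q^(s∕2)` if `s` is odd and `s ≤ n₂`, else `0` (`s ≥ 1`). [cite: Rogawski1990, §4.9 Prop. 4.9.1 (a) p. 55] -/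
theorem finsum_stabiliserWeight_stratumTwo_T2 (hD : IsRamifiedQuadraticDatum σ ϖ d t) (hE : IsElementDatum σ ϖ N₀ α β n₁ n₂ n₃)
    (hT : (T : Matrix (Fin 3) (Fin 3) K) = Matrix.diagonal ![α, β, 1]) (s : ℕ) (hs : 1 ≤ s) :
    ∑ᶠ M ∈ stratumTwo σ ϖ T ![s, 0, s], stabiliserWeight σ M = if ¬ 2 ∣ s ∧ s ≤ n₂ then ((Fintype.card 𝓀[K] : ℚ) ^ (s / 2)) else 0 := by
  obtain ⟨hσ, hvσ, hϖ, hfix, hd, -, -⟩ := hD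
  obtain ⟨hαn, hβn, -, -, -, -, h₂, -, -, -, -⟩ := hE
  have hα := v_eq_one_of_mul_map_eq_one hvσ hαn
  have hβ := v_eq_one_of_mul_map_eq_one hvσ hβn
  have hset : stratumTwo σ ϖ T ![s, 0, s] = {M | M ∈ normalisedStableLattices T ∧
      (∃ D : Fin 3 → K, (∀ i, σ (D i) = D i ∧ D i ≠ 0) ∧ IsVertexLattice σ ϖ (Matrix.diagonal D) 2 M) ∧
      ∃ y : K, Valued.v y = 1 ∧ M = latt (!![1, 0, 0; 0, 1, 0; y, 0, ϖ ^ s] : Matrix (Fin 3) (Fin 3) K)} :=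
    Set.ext fun M => ⟨fun ⟨h1, h2, h3⟩ => ⟨h1, h2, (hasAxis_axis2_iff hϖ h1 hs).1 h3⟩, fun ⟨h1, h2, h3⟩ => ⟨h1, h2, (hasAxis_axis2_iff hϖ h1 hs).2 h3⟩⟩
  rw [hset]
  split_ifs with hc
  · rw [← Nat.card_eq_fintype_card]
    exact finsum_stabiliserWeight_axis2StratumTwo hσ hvσ hfix hϖ hd T hT hα hβ (map_one _) h₂ hc.1 hc.2
  · rcases not_and_or.1 hc with heven | hlt
    · rw [axis2StratumTwo_eq_empty_of_two_dvd hvσ hfix hϖ T (not_not.1 heven), finsum_mem_empty]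
    · rw [axis2StratumTwo_eq_empty σ hϖ T hT hα hβ (map_one _) h₂ (not_le.1 hlt), finsum_mem_empty]

end Sockets

end Summit.HodgeConjecture.HodgeConjecture.Cruxes.H413.F0P3cDyRamDiagonalSplitCountTwoSockets

end
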